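import Literature.Geometry.Lorentzian.CoordAdjMomGSBound
import Literature.Geometry.Lorentzian.CoordAdjointCutoffLapse
import Literature.Geometry.Lorentzian.CoordFormVectorCauchySchwarz
import HarnessLib

/-!
# The KID rows on cut-off fields: the commutator `[P*, χ]` and its pointwise size

Topic `Literature/Geometry/Lorentzian`, coordinate tensor calculus `MetricCoord`. Everything here is
PROVED; no definition and no statement of `Prop` type is introduced.

For the rows `R_K(N,Y) = adjHamK N + adjMomKS Y`, `R_G(N,Y) = adjHamG N + adjMomGS Y` of the
KID operator `P*` and a cut-off function `χ`,
`R(χN, χY) = χ R(N,Y) + [R, χ](N,Y)` with a commutator of order `≤ 1` in `(N, Y)` whose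
coefficients are `dχ`, `Hess χ`, `Δχ` (`CoordAdjointCutoff.lean`, `CoordAdjointCutoffLapse.lean`).
This file assembles the two rows and bounds the commutators pointwise — the localisation step in
the proof of the coercivity inequalities (3.1)–(3.5) of Chruściel–Delay (Mém. SMF 94 (2003), §3):

* `normSqAt_smulRight` — `|φ ⊗ ψ|² = |φ|²|ψ|²`; `form_apply_sharpAt_le` — `|K(v,·)|² ≤ |K|²|v|²`;
* `kidRowK_cutoff`, `IsMetricOn.kidRowG_cutoff` — the two rows on `(χN, χY)`;
* `IsMetricOn.normSqAt_kidRowK_cutoff_le` —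
  `|R_K(χN,χY)|² ≤ 2χ²|R_K(N,Y)|² + 4(1+n)|dχ|²|Y|²`;
* `IsMetricOn.normSqAt_kidRowG_cutoff_le` —
  `|R_G(χN,χY)|² ≤ 2χ²|R_G(N,Y)|² + 8[(2n(Δχ)² + |Hess χ|²)N² + (8n+4)|dχ|²|∇N|² + ¾(5+n)|dχ|²|K|²|Y|²]`.

## References

* P. T. Chruściel, E. Delay, Mém. Soc. Math. Fr. 94 (2003), §3 (proofs of Prop. 3.1, 3.3).
  [ChruscielDelay2003]
* B. O'Neill, Semi-Riemannian geometry (1983), Ch. 2–3. [ONeill1983]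
-/

noncomputable section

set_option maxSynthPendingDepth 3

open Set Filter Module Function
open scoped Topology ContDiff

namespace Literature.Geometry.Lorentzian

namespace MetricCoord

variable {E : Type*} [NormedAddCommGroup E] [NormedSpace ℝ E] [FiniteDimensional ℝ E]
  {G K : E → E →L[ℝ] E →L[ℝ] ℝ} {V : Set E} {x : E} {χ N : E → ℝ} {Y : E → E}

/-! ### Two frame computations -/

section Frame

variable {κ : Type*} [Fintype κ] [DecidableEq κ] (e : Basis κ ℝ E)
  (he : ∀ i j, G x (e i) (e j) = if i = j then 1 else 0)
include he

/-- **`|φ ⊗ ψ|²_G = |φ|²_G |ψ|²_G`** (`|φ|² = φ(♯φ)`) in a `G x`-orthonormal basis.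
[cite: ONeill1983, Ch. 3, pp. 60–61] -/
theorem normSqAt_smulRight_frame (hi : (G x).IsInvertible) (hs : ∀ v w, G x v w = G x w v)
    (φ ψ : E →L[ℝ] ℝ) :
    normSqAt G x (φ.smulRight ψ) = φ (sharpAt G x φ) * ψ (sharpAt G x ψ) := by
  rw [normSqAt_eq_sum_frame e he hi hs, apply_sharpAt_eq_sum_frame e he hi hs,
    apply_sharpAt_eq_sum_frame e he hi hs, Finset.sum_mul_sum]
  refine Finset.sum_congr rfl fun i _ ↦ Finset.sum_congr rfl fun j _ ↦ ?_
  simp only [ContinuousLinearMap.smulRight_apply, FunLike.coe_smul, Pi.smul_apply,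
    smul_eq_mul]
  ring

/-- **`|K(v,·)|²_G ≤ |K|²_G |v|²_G`** in a `G x`-orthonormal basis (Cauchy–Schwarz row by row).
[cite: ONeill1983, Ch. 3, pp. 60–61] -/
theorem form_apply_sharpAt_le_frame (hi : (G x).IsInvertible) (hs : ∀ v w, G x v w = G x w v)
    (B : E →L[ℝ] E →L[ℝ] ℝ) (v : E) :
    B v (sharpAt G x (B v)) ≤ normSqAt G x B * G x v v := by
  rw [apply_sharpAt_eq_sum_frame e he hi hs, normSqAt_eq_sum_frame e he hi hs,
    covector_apply_eq_sum_frame e he (G x v) v]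
  -- `B v (e c) = Σ_p G(v,e_p) B(e_p,e_c)`
  have hrow : ∀ c, B v (e c) = ∑ p, G x v (e p) * B (e p) (e c) := fun c ↦ by
    conv_lhs => rw [← sum_apply_smul_of_orthonormal e he v]
    simp only [map_sum, map_smul, FunLike.coe_sum, Finset.sum_apply,
      FunLike.coe_smul, Pi.smul_apply, smul_eq_mul]
  have hcs : ∀ c, B v (e c) * B v (e c) ≤
      (∑ p, G x v (e p) ^ 2) * ∑ p, B (e p) (e c) ^ 2 := fun c ↦ by
    rw [hrow c, ← sq]
    exact Finset.sum_mul_sq_le_sq_mul_sq Finset.univ (fun p ↦ G x v (e p)) (fun p ↦ B (e p) (e c))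
  calc ∑ c, B v (e c) * B v (e c)
      ≤ ∑ c, (∑ p, G x v (e p) ^ 2) * ∑ p, B (e p) (e c) ^ 2 := Finset.sum_le_sum fun c _ ↦ hcs c
    _ = (∑ i, ∑ j, B (e i) (e j) ^ 2) * ∑ p, G x v (e p) * G x v (e p) := by
        rw [← Finset.mul_sum, Finset.sum_comm, mul_comm]
        refine congrArg₂ (· * ·) rfl (Finset.sum_congr rfl fun p _ ↦ by rw [sq])

end Frame

/-- **`|φ ⊗ ψ|²_G = |φ|²_G |ψ|²_G`** at a symmetric positive definite point.
[cite: ONeill1983, Ch. 3, pp. 60–61] -/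
theorem normSqAt_smulRight (hG : IsMetricOn G V) (hx : x ∈ V)
    (hpos : ∀ v : E, v ≠ 0 → 0 < G x v v) (φ ψ : E →L[ℝ] ℝ) :
    normSqAt G x (φ.smulRight ψ) = φ (sharpAt G x φ) * ψ (sharpAt G x ψ) := by
  have hi := hG.isInvertible x hx
  have hs := hG.symm x hx
  obtain ⟨e, he⟩ := exists_orthonormal_basis hs hpos
  exact normSqAt_smulRight_frame e he hi hs φ ψ

/-- **`|K(v,·)|²_G ≤ |K|²_G |v|²_G`** at a symmetric positive definite point.
[cite: ONeill1983, Ch. 3, pp. 60–61] -/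
theorem form_apply_sharpAt_le (hG : IsMetricOn G V) (hx : x ∈ V)
    (hpos : ∀ v : E, v ≠ 0 → 0 < G x v v) (B : E →L[ℝ] E →L[ℝ] ℝ) (v : E) :
    B v (sharpAt G x (B v)) ≤ normSqAt G x B * G x v v := by
  have hi := hG.isInvertible x hx
  have hs := hG.symm x hx
  obtain ⟨e, he⟩ := exists_orthonormal_basis hs hpos
  exact form_apply_sharpAt_le_frame e he hi hs B v

/-! ### The rows on cut-off fields -/

omit [FiniteDimensional ℝ E] in
/-- **The `κ`-row on `(χN, χY)`**:
`R_K(χN, χY) = χ R_K(N,Y) − sym(dχ ⊗ G(Y,·)) + dχ(Y) G`. [cite: ChruscielDelay2003, §3] -/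
theorem kidRowK_cutoff [FiniteDimensional ℝ E] (hχ : DifferentiableAt ℝ χ x)
    (hY : DifferentiableAt ℝ Y x) (N : E → ℝ) :
    adjHamK G K (fun y ↦ χ y * N y) x + adjMomKS G (fun y ↦ χ y • Y y) x =
      χ x • (adjHamK G K N x + adjMomKS G Y x)
        - symAt ((fderiv ℝ χ x).smulRight (G x (Y x))) + (fderiv ℝ χ x (Y x)) • G x := by
  rw [adjHamK_mul, adjMomKS_smul hχ hY, smul_add]
  abel

/-- **The `γ`-row on `(χN, χY)`**: `R_G(χN, χY) = χ R_G(N,Y) + [R_G, χ](N,Y)` with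
`[R_G, χ](N,Y) = −(NΔχ + 2dχ(♯dN)) G + N Hess χ + dχ⊗dN + dN⊗dχ + sym(dχ ⊗ K(Y,·)) − ½dχ(♯K(Y,·)) G − ½dχ(Y) K`.
[cite: ChruscielDelay2003, §3] -/
theorem IsMetricOn.kidRowG_cutoff (hG : IsMetricOn G V) (hx : x ∈ V)
    (hχ : ContDiffAt ℝ 2 χ x) (hN : ContDiffAt ℝ 2 N x) (hY : DifferentiableAt ℝ Y x)
    (hKY : DifferentiableAt ℝ (fun y ↦ sharpAt G y (K y (Y y))) x) :
    adjHamG G K (fun y ↦ χ y * N y) x + adjMomGS G K (fun y ↦ χ y • Y y) x =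
      χ x • (adjHamG G K N x + adjMomGS G K Y x)
        + (-(N x * lapAt G χ x + 2 * fderiv ℝ χ x (sharpAt G x (fderiv ℝ N x))) • G x
          + N x • hessAt G χ x
          + ((fderiv ℝ χ x).smulRight (fderiv ℝ N x) + (fderiv ℝ N x).smulRight (fderiv ℝ χ x))
          + (symAt ((fderiv ℝ χ x).smulRight (K x (Y x)))
            - (2⁻¹ * fderiv ℝ χ x (sharpAt G x (K x (Y x)))) • G x
            - (2⁻¹ * fderiv ℝ χ x (Y x)) • K x)) := by
  rw [hG.adjHamG_mul hx hχ hN, adjMomGS_smul (hχ.differentiableAt (by simp)) hY hKY, smul_add,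
    neg_smul]
  abel

/-! ### Pointwise size of the commutators -/

/-- **`|R_K(χN,χY)|² ≤ 2χ²|R_K(N,Y)|² + 4(1+n)|dχ|²|Y|²`** at a point of `V` (`|dχ|² = |∇χ|²_G`).
[cite: ChruscielDelay2003, §3] -/
theorem IsMetricOn.normSqAt_kidRowK_cutoff_le (hG : IsMetricOn G V) (hx : x ∈ V)
    (hpos : ∀ v : E, v ≠ 0 → 0 < G x v v) (hχ : DifferentiableAt ℝ χ x)
    (hY : DifferentiableAt ℝ Y x) (N : E → ℝ) :
    normSqAt G x (adjHamK G K (fun y ↦ χ y * N y) x + adjMomKS G (fun y ↦ χ y • Y y) x) ≤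
      2 * χ x ^ 2 * normSqAt G x (adjHamK G K N x + adjMomKS G Y x)
        + 4 * (1 + (finrank ℝ E : ℝ)) * gradSqAt G χ x * G x (Y x) (Y x) := by
  have hi := hG.isInvertible x hx
  have hs := hG.symm x hx
  set φ := fderiv ℝ χ x
  set R := adjHamK G K N x + adjMomKS G Y x
  have heq : adjHamK G K (fun y ↦ χ y * N y) x + adjMomKS G (fun y ↦ χ y • Y y) x =
      χ x • R + (-symAt (φ.smulRight (G x (Y x))) + (φ (Y x)) • G x) := by
    rw [kidRowK_cutoff hχ hY N]; abel
  rw [heq]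
  have h1 := normSqAt_add_le hG hx hpos (χ x • R) (-symAt (φ.smulRight (G x (Y x))) + (φ (Y x)) • G x)
  have h2 := normSqAt_add_le hG hx hpos (-symAt (φ.smulRight (G x (Y x)))) ((φ (Y x)) • G x)
  rw [normSqAt_smul] at h1
  have hneg : normSqAt G x (-symAt (φ.smulRight (G x (Y x)))) =
      normSqAt G x (symAt (φ.smulRight (G x (Y x)))) := by
    rw [← neg_one_smul ℝ (symAt _), normSqAt_smul]; ring
  rw [hneg, normSqAt_smul, normSqAt_metric hi hs] at h2
  -- the two pieces
  have hgrad : ∀ θ : E →L[ℝ] ℝ, 0 ≤ θ (sharpAt G x θ) := fun θ ↦ by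
    rw [← apply_sharpAt_apply hi]
    by_cases hz : sharpAt G x θ = 0
    · simp [hz]
    · exact (hpos _ hz).le
  have hc : 0 ≤ gradSqAt G χ x := by rw [gradSqAt_apply]; exact hgrad φ
  have hYY : 0 ≤ G x (Y x) (Y x) := by
    by_cases hz : Y x = 0
    · simp [hz]
    · exact (hpos _ hz).le
  have hsym : normSqAt G x (symAt (φ.smulRight (G x (Y x)))) ≤ gradSqAt G χ x * G x (Y x) (Y x) := by
    refine (normSqAt_symAt_le hG hx hpos _).trans (le_of_eq ?_)
    rw [normSqAt_smulRight hG hx hpos, gradSqAt_apply, hs (Y x), apply_sharpAt_apply hi]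
  have happ : φ (Y x) ^ 2 ≤ gradSqAt G χ x * G x (Y x) (Y x) := by
    rw [gradSqAt_apply]; exact covector_apply_sq_le hG hx hpos φ (Y x)
  have hn : (0 : ℝ) ≤ finrank ℝ E := Nat.cast_nonneg _
  nlinarith [h1, h2, hsym, happ, mul_le_mul_of_nonneg_left happ hn, sq_nonneg (χ x),
    normSqAt_nonneg_of_pos hG hx hpos R]

/-- **`|R_G(χN,χY)|² ≤ 2χ²|R_G(N,Y)|² + 8[(2n(Δχ)² + |Hess χ|²)N² + (8n+4)|dχ|²|∇N|² + ¾(5+n)|dχ|²|K|²|Y|²]`**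
at a point of `V`. [cite: ChruscielDelay2003, §3] -/
theorem IsMetricOn.normSqAt_kidRowG_cutoff_le (hG : IsMetricOn G V) (hx : x ∈ V)
    (hpos : ∀ v : E, v ≠ 0 → 0 < G x v v) (hχ : ContDiffAt ℝ 2 χ x) (hN : ContDiffAt ℝ 2 N x)
    (hY : DifferentiableAt ℝ Y x) (hKY : DifferentiableAt ℝ (fun y ↦ sharpAt G y (K y (Y y))) x) :
    normSqAt G x (adjHamG G K (fun y ↦ χ y * N y) x + adjMomGS G K (fun y ↦ χ y • Y y) x) ≤
      2 * χ x ^ 2 * normSqAt G x (adjHamG G K N x + adjMomGS G K Y x)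
        + 8 * ((2 * (finrank ℝ E : ℝ) * lapAt G χ x ^ 2 + normSqAt G x (hessAt G χ x)) * N x ^ 2
          + (8 * (finrank ℝ E : ℝ) + 4) * gradSqAt G χ x * gradSqAt G N x
          + 3 / 4 * (5 + (finrank ℝ E : ℝ)) * gradSqAt G χ x * normSqAt G x (K x)
            * G x (Y x) (Y x)) := by
  have hi := hG.isInvertible x hx
  have hs := hG.symm x hx
  set n : ℝ := (finrank ℝ E : ℝ) with hndef
  set φ := fderiv ℝ χ x
  set ψ := fderiv ℝ N x
  set R := adjHamG G K N x + adjMomGS G K Y x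
  set A₁ : E →L[ℝ] E →L[ℝ] ℝ := -(N x * lapAt G χ x + 2 * φ (sharpAt G x ψ)) • G x
  set A₂ : E →L[ℝ] E →L[ℝ] ℝ := N x • hessAt G χ x
  set A₃ : E →L[ℝ] E →L[ℝ] ℝ := φ.smulRight ψ + ψ.smulRight φ
  set A₄ : E →L[ℝ] E →L[ℝ] ℝ := symAt (φ.smulRight (K x (Y x)))
    - (2⁻¹ * φ (sharpAt G x (K x (Y x)))) • G x - (2⁻¹ * φ (Y x)) • K x
  have heq : adjHamG G K (fun y ↦ χ y * N y) x + adjMomGS G K (fun y ↦ χ y • Y y) x =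
      χ x • R + (A₁ + A₂ + A₃ + A₄) := hG.kidRowG_cutoff hx hχ hN hY hKY
  rw [heq]
  -- nonnegativity facts
  have nn := fun β ↦ normSqAt_nonneg_of_pos hG hx hpos β
  have hgrad : ∀ θ : E →L[ℝ] ℝ, 0 ≤ θ (sharpAt G x θ) := fun θ ↦ by
    rw [← apply_sharpAt_apply hi]
    by_cases hz : sharpAt G x θ = 0
    · simp [hz]
    · exact (hpos _ hz).le
  have hc : 0 ≤ gradSqAt G χ x := by rw [gradSqAt_apply]; exact hgrad φ
  have hgN : 0 ≤ gradSqAt G N x := by rw [gradSqAt_apply]; exact hgrad ψ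
  have hYY : 0 ≤ G x (Y x) (Y x) := by
    by_cases hz : Y x = 0
    · simp [hz]
    · exact (hpos _ hz).le
  have hn0 : 0 ≤ n := Nat.cast_nonneg _
  -- splitting
  have h0 := normSqAt_add_le hG hx hpos (χ x • R) (A₁ + A₂ + A₃ + A₄)
  have h4 := normSqAt_add_four_le hG hx hpos A₁ A₂ A₃ A₄
  rw [normSqAt_smul] at h0
  -- `|A₁|²`
  have hA₁ : normSqAt G x A₁ ≤ 2 * n * (N x ^ 2 * lapAt G χ x ^ 2 + 4 * (gradSqAt G χ x * gradSqAt G N x)) := by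
    have e1 : normSqAt G x A₁ = (N x * lapAt G χ x + 2 * φ (sharpAt G x ψ)) ^ 2 * n := by
      simp only [A₁]; rw [normSqAt_smul, normSqAt_metric hi hs]; ring
    have hcs : φ (sharpAt G x ψ) ^ 2 ≤ gradSqAt G χ x * gradSqAt G N x := by
      rw [gradSqAt_apply, gradSqAt_apply, ← apply_sharpAt_apply hi ψ (sharpAt G x ψ)]
      exact covector_apply_sq_le hG hx hpos φ _
    rw [e1]
    nlinarith [hcs, sq_nonneg (N x * lapAt G χ x - 2 * φ (sharpAt G x ψ))]
  -- `|A₂|²`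
  have hA₂ : normSqAt G x A₂ = N x ^ 2 * normSqAt G x (hessAt G χ x) := by
    simp only [A₂]; rw [normSqAt_smul]
  -- `|A₃|²`
  have hA₃ : normSqAt G x A₃ ≤ 4 * (gradSqAt G χ x * gradSqAt G N x) := by
    have h := normSqAt_add_le hG hx hpos (φ.smulRight ψ) (ψ.smulRight φ)
    rw [normSqAt_smulRight hG hx hpos, normSqAt_smulRight hG hx hpos] at h
    rw [gradSqAt_apply, gradSqAt_apply]
    simp only [A₃]
    linarith [h]
  -- `|A₄|²`
  have hA₄ : normSqAt G x A₄ ≤ 3 / 4 * (5 + n) * (gradSqAt G χ x * normSqAt G x (K x) * G x (Y x) (Y x)) := by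
    have h := normSqAt_add_three_le hG hx hpos (symAt (φ.smulRight (K x (Y x))))
      (-((2⁻¹ * φ (sharpAt G x (K x (Y x)))) • G x)) (-((2⁻¹ * φ (Y x)) • K x))
    have e4 : A₄ = symAt (φ.smulRight (K x (Y x))) + -((2⁻¹ * φ (sharpAt G x (K x (Y x)))) • G x)
        + -((2⁻¹ * φ (Y x)) • K x) := by simp only [A₄, sub_eq_add_neg]
    rw [← e4, ← neg_smul, ← neg_smul, normSqAt_smul, normSqAt_smul, normSqAt_metric hi hs] at h
    -- the three pieces
    have hKY : K x (Y x) (sharpAt G x (K x (Y x))) ≤ normSqAt G x (K x) * G x (Y x) (Y x) :=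
      form_apply_sharpAt_le hG hx hpos (K x) (Y x)
    have p1 : normSqAt G x (symAt (φ.smulRight (K x (Y x)))) ≤
        gradSqAt G χ x * (normSqAt G x (K x) * G x (Y x) (Y x)) := by
      refine (normSqAt_symAt_le hG hx hpos _).trans ?_
      rw [normSqAt_smulRight hG hx hpos, gradSqAt_apply]
      exact mul_le_mul_of_nonneg_left hKY (hgrad φ)
    have p2 : φ (sharpAt G x (K x (Y x))) ^ 2 ≤ gradSqAt G χ x * (normSqAt G x (K x) * G x (Y x) (Y x)) := by
      have h1 := covector_apply_sq_le hG hx hpos φ (sharpAt G x (K x (Y x)))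
      rw [apply_sharpAt_apply hi] at h1
      rw [gradSqAt_apply]
      exact h1.trans (mul_le_mul_of_nonneg_left hKY (hgrad φ))
    have p3 : φ (Y x) ^ 2 * normSqAt G x (K x) ≤ gradSqAt G χ x * (normSqAt G x (K x) * G x (Y x) (Y x)) := by
      have h1 := covector_apply_sq_le hG hx hpos φ (Y x)
      rw [gradSqAt_apply]
      nlinarith [mul_le_mul_of_nonneg_right h1 (nn (K x))]
    nlinarith [h, p1, p2, p3, mul_le_mul_of_nonneg_left p2 hn0]
  -- assemble
  have hsum : normSqAt G x (A₁ + A₂ + A₃ + A₄) ≤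
      4 * (2 * n * (N x ^ 2 * lapAt G χ x ^ 2 + 4 * (gradSqAt G χ x * gradSqAt G N x))
        + N x ^ 2 * normSqAt G x (hessAt G χ x) + 4 * (gradSqAt G χ x * gradSqAt G N x)
        + 3 / 4 * (5 + n) * (gradSqAt G χ x * normSqAt G x (K x) * G x (Y x) (Y x))) := by
    linarith [h4, hA₁, hA₂.le, hA₃, hA₄]
  have hR := nn R
  nlinarith [h0, hsum, sq_nonneg (χ x)]

end MetricCoord

end Literature.Geometry.Lorentzian

end
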